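import Summits.BirchSwinnertonDyer.Rank1Residual.X11b.Three.RouteR1LowerFromDivisibility
import HarnessLib

/-!
# X11b at `p = 3`, route R1 — H2∃⁻@3, the value at `𝟙` AS ITS OWN TYPED INPUT at route R1@3's
# erratum data (`Three.BDPValueCoreFrameOnTree₃ W`): the one-sided shape (2.4)♭@3 SPLITS into a
# value-free core and a value half, the latter supplied by THEOREM C♯ of cell bsd-stepL

HONEST FRAMING (cell `bsd-stepL`, run/shared/lean/pub/bsd-stepL/, seat `bsd-stepL-bdp` g6; the
Rank1Residual library files keep the b2b-bsdres framing verbatim): the goal is to DELETE the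
COMBINATION-SHAPED residual classes of the Birch–Swinnerton-Dyer formula for ALL analytic-rank `≤ 1`
elliptic curves over `ℚ` — "full BSD formula for every rank `≤ 1` curve in class `C`" assembled
STRICTLY from published theorems — so that the rank-`≤ 1` remainder becomes exactly the
CONSTRUCTION-SHAPED classes, which are TYPED (missing-input `Prop`s), NOT attempted. This is not
"finishing BSD". Team N8/O2 (X11 ∧ `r = 1` at `p = 3`: `3 ∥ N`, `E[3]` irreducible), route R1@3 (the
erratum road at `3`); no claim beyond the stated class and data; NOTHING is booked; O2 stays OPEN.

TWO `Prop`-valued SHAPES with bodies (nothing asserted) and THEOREMS (no named fact, no `sorry`).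

## Why this file (the `p = 3` twin of `X11b/RouteR1BDPValueCoreFrame.lean`, p408571)

At `p ≥ 5` the value conjunct of the erratum road's one-sided shape is supplied from print on
semistable pairs (`thm32_exists_isBDPLFunction_valueAtOne`: `5 ≤ p`, `Squarefree N`) and isolated as
the shape `R1.BDPValueCoreFrameOnTree W p` elsewhere (p408571). At `p = 3` the one-sided shape of
record `Three.IMCDivIntFrameAtErratumData₃ W` (x11b3 p6; frame ∧ VALUE ∧ divisibility for SOME ♭-frame
at the R1@3 erratum data) has NO printed supplier of its value conjunct at all (`thm32` needs
`5 ≤ p`; the cell's Theorem A ∕ H1@3 is the EXISTENCE of a frame, not its value). This file splits it: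

* §1 **`Three.BDPValueCoreFrameOnTree₃ W`** (H2∃⁻@3): at every R1@3 erratum datum (binders of
  `Three.IMCDivIntFrameAtErratumData₃` VERBATIM) there is an `R₀`-frame `(Ω_K ≠ 0, Ω_p ∈ R₀ˣ,
  L ∈ R₀⟦T⟧)` with Castella's interpolation property for `f_{Dt}` AND `L(𝟙) = u·((1 − a₃(E)·3⁻¹)·
  log_{ω_E} P)²`, `u ∈ R₀ˣ` — binder for binder the statement THEOREM C♯ of cell bsd-stepL (PROOF-BDP
  §21) proves at memo level at `p = 3` (the ψ-free classical frame of Castella–Hsieh 2018 §3 under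
  their (Heeg′) with `N⁻ = q`; `p = 3` is an odd prime split in `K`); the tree asserts nothing.
  **`Three.IMCDivIntCoreFrameAtErratumData₃ W`**: the value-free core of the shape of record (frame ∧
  divisibility), the `p = 3` twin of multr1-p4's `P2.IMCDivIntCoreFrameAtErratumData`.
* §2 `imcDivIntCoreFrameAtErratumData₃_of_imcDivIntFrame` (forget the value) and
  **`imcDivIntFrameAtErratumData₃_of_bdpValueCoreFrame₃_of_core`**: core ∧ H2∃⁻@3 ⟹ the shape of
  record, by ♭-value rigidity across periods (`R1.bdpValueAtOneIntAt_of_isBDPLFunctionInt`, any odd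
  `p`, here `3 ≠ 2`; `K` imaginary quadratic as an erratum field).
* §3 the records of `Three/RouteR1LowerFromDivisibility.lean` §4 re-keyed to the split inputs:
  `R1.bsdp_three_of_bdpValueCoreFrame₃_of_core_of_not_dvd_tamagawaProduct` (class-wide binders) and
  `R1.bsdp_three_of_bdpValueCoreFrame₃_of_core_at` (one curve, one datum).

So on the 940 TRUE-OPEN R1@3 carriers of atom A1 the erratum road at `3` asks — beyond published
facts and cited PT/EP — for TWO named shapes: H2∃⁻@3 (memo THEOREM C♯ of cell bsd-stepL) and the
value-free divisibility at `3` (the cell's Road HF «AUDIT (X₁ ✓)» on the 472 semistable carriers;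
method-void MI-W3 elsewhere). CONDITIONAL; nothing booked; labels UNCHANGED; O2 OPEN.

References: [Castella2018] Thms. 3.1, 3.2, §5 (arXiv:1704.06608 pp. 9, 12); [Castella2018Erratum]
(2.4), Thm. 1.1; [CastellaHsieh2018] §3.2–3.3 (Heeg′), Prop. 3.4, Def. 3.5 (arXiv:1505.08165 pp. 9–11);
[Hsieh2014] Prop. 3.9, Thm. 3.18, p. 7; [KrizLi2019] §2.
-/

noncomputable section

open scoped Classical

open WeierstrassCurve NumberField IsDedekindDomain Field PowerSeries
open Literature.NumberTheory.EllipticCurves Literature.NumberTheory.EllipticCurves.GreenbergSelmer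
  Literature.NumberTheory.EllipticCurves.ModularForms Literature.NumberTheory.EllipticCurves.Rank1Residual
  Literature.NumberTheory.EllipticCurves.Rank1Residual.Typed Literature.NumberTheory.EllipticCurves.Castella2018
  Literature.NumberTheory.GaloisRepresentations Literature.NumberTheory.GaloisCohomology
open Summit.BirchSwinnertonDyer.Rank1Residual.X11b.AcSelmer Summit.BirchSwinnertonDyer.Rank1Residual.X11b.Halves

namespace Summit.BirchSwinnertonDyer.Rank1Residual.X11b.Three

/-! ### §1 The two shapes at `p = 3` -/

section Shape

variable (W : WeierstrassCurve ℚ) [W.IsElliptic] [W.IsGloballyMinimal]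

/-- **H2∃⁻@3 — the value at `𝟙` of SOME `R₀`-frame at every erratum datum of route R1@3 (typed shape;
the binders of `Three.IMCDivIntFrameAtErratumData₃` VERBATIM).** At every datum (`IsX11Three W`, the
A′-locus at `3`, a non-split multiplicative `q ≠ 3` with `3 ∤ v_q(Δ_min)`, an erratum field `K` for `q`
with [Cas20, §2.5] at `N_E/3`, a parametrisation datum of level `N_E` with `3 ∤ c`, its Heegner point
`P` of infinite order read through the infinite place `w₀`), every anticyclotomic `(κ, γ)`, every
`ι' : ℚ̄₃ ≅ ℂ` and every `e : K → ℚ₃` inducing `𝔭_{ι'}`: THERE IS a frame `(Ω_K ≠ 0, Ω_p ∈ R₀ˣ,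
L ∈ R₀⟦T⟧)` with `IsBDPLFunction ι' 𝔭_{ι'} κ γ f_{Dt} Ω_K Ω_p L` AND the value
`L(𝟙) = u·((1 − a₃(E)·3⁻¹)·log_{ω_E} P)²`, `u ∈ R₀ˣ` (`R1.BDPValueAtOneOnTreeAt W 3 e P L (a₃(E))`). The
typed form at `p = 3` of cell bsd-stepL's memo THEOREM C♯ (ψ-free classical frame of Castella–Hsieh
2018 §3 under (Heeg′), `N⁻ = q`, at the odd split prime `3 ∥ N`), which the tree does NOT assert; no
printed supplier exists at `3`. A predicate on `W`; every result using it is CONDITIONAL.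
[cite: Castella2018, Thm. 3.1, display (3.2) and Thm. 3.2 (arXiv:1704.06608 p. 9) (shape only; nothing asserted)]
[cite: CastellaHsieh2018, §3.3 hypothesis (Heeg′), Prop. 3.4 and Def. 3.5 (arXiv:1505.08165 pp. 9–11) (the frame the memo uses; nothing asserted)] -/
def BDPValueCoreFrameOnTree₃ : Prop :=
  ∀ [NeZero (W.conductorNorm ℤ)] (q : ℕ) [Fact q.Prime] (K : Type) [Field K] [NumberField K]
    (Dt : ModularParametrizationData W (W.conductorNorm ℤ))
    (H : HeegnerDatum (W.conductorNorm ℤ) (NumberField.discr K)) (w₀ : InfinitePlace K)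
    (P : (W.baseChange K).toAffine.Point), IsX11Three W → X11.AprimeLocusAt W 3 →
    q ≠ 3 → Mult W q → ¬ W.HasSplitMultiplicativeReductionAtPrime q →
    ¬ 3 ∣ padicValInt q W.minimalDiscriminantInt → IsErratumField W K q →
    Cas20Standing K 3 (W.conductorNorm ℤ / 3) →
    WeierstrassCurve.Affine.Point.map w₀.embedding.toRatAlgHom P = heegnerPointComplex Dt H →
    ¬ (3 : ℤ) ∣ Dt.c → ¬ IsOfFinAddOrder P →
    ∀ (κ : ZpExtension K 3), κ.IsAnticyclotomic →
      ∀ (γ : Field.absoluteGaloisGroup K) [Fact (κ.IsTopGenerator γ)] (ι' : PadicAlgCl 3 ≃+* ℂ)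
        (e : K →+* ℚ_[3]),
        (∀ k : 𝓞 K, k ∈ (primeOfEmbeddingDatum 3 ι' w₀.embedding).asIdeal ↔ ‖e (k : K)‖ < 1) →
        ∃ (ΩK : ℂ) (Ωp : (unrIntegers 3)ˣ) (L : UnrSeries 3), ΩK ≠ 0 ∧
          IsBDPLFunction ι' (primeOfEmbeddingDatum 3 ι' w₀.embedding) κ γ Dt.f ΩK
            ((Ωp : unrIntegers 3) : ℂ_[3]) L ∧
          R1.BDPValueAtOneOnTreeAt W 3 e P L (W.LFunction 3)

/-- **(2.4)♭ ONE-SIDED, WITHOUT THE VALUE CONJUNCT, at route R1@3's erratum data (OPEN shape)** — the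
body of `Three.IMCDivIntFrameAtErratumData₃` VERBATIM with the value conjunct deleted (the `p = 3`
twin of multr1-p4's `P2.IMCDivIntCoreFrameAtErratumData`): per datum a ♭-frame `(Ω_K ≠ 0,
‖Ω_p‖ = 1, Q ∈ 𝓞_{ℂ₃}⟦T⟧)` with Castella's interpolation property and the DIVISIBILITY
`Ch_Λ(X_ac^∅(E[3^∞]))·𝓞_{ℂ₃}⟦T⟧ ⊆ (Q)`. OPEN at `3`: NO source, NO announcement (cell bsd-stepL's Road
HF is an in-cell audited argument on the semistable carriers only). A predicate on `W`; NEVER a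
theorem in this cell; every result using it is CONDITIONAL; shape only; nothing asserted.
[cite: Castella2018, Thm. 3.1 and display (3.2) (arXiv:1704.06608 p. 9) (shape only; nothing asserted)]
[cite: Castella2018Erratum, (2.4) (p. 4) (shape only; nothing asserted)] -/
def IMCDivIntCoreFrameAtErratumData₃ : Prop :=
  ∀ [NeZero (W.conductorNorm ℤ)] (q : ℕ) [Fact q.Prime] (K : Type) [Field K] [NumberField K]
    (Dt : ModularParametrizationData W (W.conductorNorm ℤ))
    (H : HeegnerDatum (W.conductorNorm ℤ) (NumberField.discr K)) (w₀ : InfinitePlace K)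
    (P : (W.baseChange K).toAffine.Point), IsX11Three W → X11.AprimeLocusAt W 3 →
    q ≠ 3 → Mult W q → ¬ W.HasSplitMultiplicativeReductionAtPrime q →
    ¬ 3 ∣ padicValInt q W.minimalDiscriminantInt → IsErratumField W K q →
    Cas20Standing K 3 (W.conductorNorm ℤ / 3) →
    WeierstrassCurve.Affine.Point.map w₀.embedding.toRatAlgHom P = heegnerPointComplex Dt H →
    ¬ (3 : ℤ) ∣ Dt.c → ¬ IsOfFinAddOrder P →
    ∀ (κ : ZpExtension K 3), κ.IsAnticyclotomic →
      ∀ (γ : Field.absoluteGaloisGroup K) [Fact (κ.IsTopGenerator γ)] (ι' : PadicAlgCl 3 ≃+* ℂ)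
        (e : K →+* ℚ_[3]),
        (∀ k : 𝓞 K, k ∈ (primeOfEmbeddingDatum 3 ι' w₀.embedding).asIdeal ↔ ‖e (k : K)‖ < 1) →
        ∃ (ΩK : ℂ) (Ωp : ℂ_[3]) (Q : PowerSeries 𝓞_ℂ_[3]), ΩK ≠ 0 ∧ ‖Ωp‖ = 1 ∧
          R1.IsBDPLFunctionInt 3 ι' (primeOfEmbeddingDatum 3 ι' w₀.embedding) κ γ Dt.f ΩK Ωp Q ∧
          (XAc.charIdeal (W.baseChange K) 3 κ (primeOfEmbeddingDatum 3 ι' w₀.embedding) ∅ γ).map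
              (PowerSeries.map (R1.toCpInt 3)) ≤ Ideal.span {Q}

end Shape

/-! ### §2 The shape of record = core ∧ H2∃⁻@3 -/

section Bridges

variable {W : WeierstrassCurve ℚ} [W.IsElliptic] [W.IsGloballyMinimal]

/-- The shape of record implies its value-free core (forget the value conjunct).
[cite: Castella2018Erratum, (2.4) (p. 4) (shape only)] -/
theorem imcDivIntCoreFrameAtErratumData₃_of_imcDivIntFrame (h : IMCDivIntFrameAtErratumData₃ W) :
    IMCDivIntCoreFrameAtErratumData₃ W := by
  intro _ q _ K _ _ Dt H w₀ P hX hl hq3 hmq hns hvq hK hCas hP hc hinf κ hκ γ _ ι' e he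
  obtain ⟨ΩK, Ωp, Q, hΩ, hΩp, hQ, -, h3At⟩ :=
    h q K Dt H w₀ P hX hl hq3 hmq hns hvq hK hCas hP hc hinf κ hκ γ ι' e he
  exact ⟨ΩK, Ωp, Q, hΩ, hΩp, hQ, h3At⟩

/-- **Core ∧ H2∃⁻@3 ⟹ the one-sided shape of record at `3`, on ANY curve.** At a datum the core gives a
♭-frame `(Ω_K, Ω_p, Q)` with interpolation ∧ divisibility; H2∃⁻@3 gives an `R₀`-frame `(Ω_K', Ω_p', L')`
of the same `(ι', 𝔭_{ι'}, κ, γ, f_{Dt})` with the value at `𝟙`, read in `𝓞_{ℂ₃}⟦T⟧`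
(`R1.isBDPLFunctionInt_map`, `R1.bdpValueAtOneIntAt_map`); ♭-value rigidity across periods
(`R1.bdpValueAtOneIntAt_of_isBDPLFunctionInt`: `3 ≠ 2`, `K` imaginary quadratic as an erratum field,
periods non-zero) moves the value to `Q`. The `p = 3` twin of p408571's
`P2.imcDivIntFrameAtErratumData_of_bdpValueCoreFrame_of_core`. CONDITIONAL on both shapes (H2∃⁻@3:
memo THEOREM C♯; the core: OPEN at `3`). [cite: Castella2018, Thm. 3.1, display (3.2) and Thm. 3.2 (arXiv:1704.06608 p. 9)]
[cite: Castella2018Erratum, (2.4) (p. 4)] -/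
theorem imcDivIntFrameAtErratumData₃_of_bdpValueCoreFrame₃_of_core (h2 : BDPValueCoreFrameOnTree₃ W)
    (h : IMCDivIntCoreFrameAtErratumData₃ W) : IMCDivIntFrameAtErratumData₃ W := by
  intro _ q _ K _ _ Dt H w₀ P hX hl hq3 hmq hns hvq hK hCas hP hc hinf κ hκ γ _ ι' e he
  obtain ⟨ΩK, Ωp, Q, hΩ, hΩp, hQ, h3At⟩ :=
    h q K Dt H w₀ P hX hl hq3 hmq hns hvq hK hCas hP hc hinf κ hκ γ ι' e he
  obtain ⟨ΩK', Ωp', L', hΩ', hL', h2'⟩ :=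
    h2 q K Dt H w₀ P hX hl hq3 hmq hns hvq hK hCas hP hc hinf κ hκ γ ι' e he
  have hp2 : (3 : ℕ) ≠ 2 := by decide
  have hΩp0 : Ωp ≠ 0 := by
    intro h0
    rw [h0, norm_zero] at hΩp
    exact zero_ne_one hΩp
  have hΩp'0 : ((Ωp' : unrIntegers 3) : ℂ_[3]) ≠ 0 := by
    rw [Ne, ZeroMemClass.coe_eq_zero]
    exact Units.ne_zero Ωp'
  exact ⟨ΩK, Ωp, Q, hΩ, hΩp, hQ,
    R1.bdpValueAtOneIntAt_of_isBDPLFunctionInt hp2 hK.1 hκ hΩ hΩ' hΩp0 hΩp'0 hQ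
      (R1.isBDPLFunctionInt_map hL') (R1.bdpValueAtOneIntAt_map h2'), h3At⟩

end Bridges

/-! ### §3 The records of `Three/RouteR1LowerFromDivisibility.lean` §4 re-keyed to the split inputs -/

section Record

/-- **`BSD(E,3)` on route R1@3's population ∩ {`3 ∤ ∏_ℓ c_ℓ(E)`} from the SPLIT inputs: H2∃⁻@3
(class-wide) ∧ the value-free core (class-wide).** `R1.bsdp_three_of_imcDivIntFrameAtErratumData₃_of_not_dvd_tamagawaProduct`
(x11b3 p6) with its one OPEN binder `hD` assembled from `h2` and `hcore` by §2 — all other binders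
token for token (published facts of both halves + cited PT/EP). CONDITIONAL on the two shapes;
deletes nothing; X11 ∧ `r = 1` at `3` stays CONSTRUCTION-SHAPED; nothing booked.
[cite: Castella2018, §5 (arXiv:1704.06608 p. 12)] [cite: McCallumLMS1991, §1 Theorem (Kolyvagin), p. 296]
[cite: JetchevSkinnerWan2017, §7.4.1 (eq:shalowerK-1)] -/
theorem R1.bsdp_three_of_bdpValueCoreFrame₃_of_core_of_not_dvd_tamagawaProduct
    (hGZ : ∀ (N : ℕ) [NeZero N] (W : WeierstrassCurve ℚ) (K : Type) [Field K] [NumberField K],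
      gross_zagier N W K)
    (hKo : ∀ (N : ℕ) [NeZero N] (W : WeierstrassCurve ℚ) (K : Type) [Field K] [NumberField K],
      kolyvagin N W K)
    (hB : ∀ (N : ℕ) [NeZero N] (W : WeierstrassCurve ℚ) (K : Type) [Field K] [NumberField K],
      Kolyvagin1990_padicValNat_card_sha_le N W K)
    (hSk : Skinner2016.thmC_padicValRat_bsd_rank_zero)
    (hGZK : rank_eq_analyticRank_of_analyticRank_le_one) (hmod : hasEntireLFunction_rat)
    (hnf : exists_isNewformOf) (hHL : HoffsteinLuo1997_exists_twist_L_one_ne_zero)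
    (hMaz : mazur_not_dvd_maninConstant_of_odd) (hNS : integral_neronScaling_of_isGloballyMinimal)
    (hGZ1 : GrossZagier1986_thm_I_7_3) (hCST : CaiShuTian2014.thm11_trivialChar)
    (hFH : friedbergHoffstein_exists_twist_ne_zero_ramifiedAt)
    (hPT : ∀ (K : Type) [Field K] [NumberField K], poitouTate_sum_localTatePairing_eq_zero K)
    (hEP : ∀ (K : Type) [Field K] [NumberField K] (v : HeightOneSpectrum (𝓞 K)),
      localEulerPoincareCharacteristic (v.adicCompletion K))
    (h2 : ∀ (W : WeierstrassCurve ℚ) [W.IsElliptic] [W.IsGloballyMinimal], BDPValueCoreFrameOnTree₃ W)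
    (hcore : ∀ (W : WeierstrassCurve ℚ) [W.IsElliptic] [W.IsGloballyMinimal],
      IMCDivIntCoreFrameAtErratumData₃ W)
    (W : WeierstrassCurve ℚ) [W.IsElliptic] [W.IsGloballyMinimal]
    (hX : IsX11Three W) (hloc : X11.AprimeRam2LocusAt W 3)
    (hq : ∃ (q : ℕ) (_ : Fact q.Prime), q ≠ 2 ∧ q ≠ 3 ∧ Mult W q ∧
      ¬ W.HasSplitMultiplicativeReductionAtPrime q ∧ ¬ 3 ∣ padicValInt q W.minimalDiscriminantInt)
    (htam : ¬ 3 ∣ W.tamagawaProduct) : BSDp W 3 :=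
  R1.bsdp_three_of_imcDivIntFrameAtErratumData₃_of_not_dvd_tamagawaProduct hGZ hKo hB hSk hGZK hmod
    hnf hHL hMaz hNS hGZ1 hCST hFH hPT hEP
    (fun W _ _ ↦ imcDivIntFrameAtErratumData₃_of_bdpValueCoreFrame₃_of_core (h2 W) (hcore W))
    W hX hloc hq htam

/-- **`BSD(E,3)` for ONE curve at ONE R1@3 datum with `3 ∤ ∏_ℓ c_ℓ(E)` from the split inputs FOR THIS
CURVE.** `R1.bsdp_three_of_imcDivIntFrameAtErratumData₃_at` (x11b3 p6) with `hD` assembled from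
`h2 : BDPValueCoreFrameOnTree₃ W` and `hcore : IMCDivIntCoreFrameAtErratumData₃ W` by §2. TEN published
named-fact binders + cited `hPT hEP` + the two shapes for this `W`; discharges nothing; nothing booked.
[cite: Castella2018, §5 (arXiv:1704.06608 p. 12)] [cite: JetchevSkinnerWan2017, §7.4.1 (eq:shalowerK-1)]
[cite: McCallumLMS1991, §1 Theorem (Kolyvagin), p. 296] -/
theorem R1.bsdp_three_of_bdpValueCoreFrame₃_of_core_at
    (hGZ : ∀ (N : ℕ) [NeZero N] (W : WeierstrassCurve ℚ) (K : Type) [Field K] [NumberField K],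
      gross_zagier N W K)
    (hKo : ∀ (N : ℕ) [NeZero N] (W : WeierstrassCurve ℚ) (K : Type) [Field K] [NumberField K],
      kolyvagin N W K)
    (hB : ∀ (N : ℕ) [NeZero N] (W : WeierstrassCurve ℚ) (K : Type) [Field K] [NumberField K],
      Kolyvagin1990_padicValNat_card_sha_le N W K)
    (hSk : Skinner2016.thmC_padicValRat_bsd_rank_zero)
    (hGZK : rank_eq_analyticRank_of_analyticRank_le_one) (hnf : exists_isNewformOf)
    (hHL : HoffsteinLuo1997_exists_twist_L_one_ne_zero) (hMaz : mazur_not_dvd_maninConstant_of_odd)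
    (hGZ1 : GrossZagier1986_thm_I_7_3) (hCST : CaiShuTian2014.thm11_trivialChar)
    (hPT : ∀ (K : Type) [Field K] [NumberField K], poitouTate_sum_localTatePairing_eq_zero K)
    (hEP : ∀ (K : Type) [Field K] [NumberField K] (v : HeightOneSpectrum (𝓞 K)),
      localEulerPoincareCharacteristic (v.adicCompletion K))
    (W : WeierstrassCurve ℚ) [W.IsElliptic] [W.IsGloballyMinimal] [NeZero (W.conductorNorm ℤ)]
    (h2 : BDPValueCoreFrameOnTree₃ W) (hcore : IMCDivIntCoreFrameAtErratumData₃ W)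
    (hX : IsX11Three W) (hloc : X11.AprimeRam2LocusAt W 3)
    (q : ℕ) [Fact q.Prime] (hq2 : q ≠ 2) (hq3 : q ≠ 3) (hmq : Mult W q)
    (hnsq : ¬ W.HasSplitMultiplicativeReductionAtPrime q)
    (hvq : ¬ 3 ∣ padicValInt q W.minimalDiscriminantInt)
    (K : Type) [Field K] [NumberField K] (hKf : IsErratumField W K q)
    (Dt : ModularParametrizationData W (W.conductorNorm ℤ))
    (H : HeegnerDatum (W.conductorNorm ℤ) (NumberField.discr K)) (ι : K →+* ℂ)
    (P : (W.baseChange K).toAffine.Point)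
    (hP : WeierstrassCurve.Affine.Point.map ι.toRatAlgHom P = heegnerPointComplex Dt H)
    (hc : ¬ (3 : ℤ) ∣ Dt.c) (hnt : ¬ IsOfFinAddOrder P) (htam : ¬ 3 ∣ W.tamagawaProduct) :
    BSDp W 3 :=
  R1.bsdp_three_of_imcDivIntFrameAtErratumData₃_at hGZ hKo hB hSk hGZK hnf hHL hMaz hGZ1 hCST hPT hEP W
    (imcDivIntFrameAtErratumData₃_of_bdpValueCoreFrame₃_of_core h2 hcore) hX hloc q hq2 hq3 hmq hnsq hvq
    K hKf Dt H ι P hP hc hnt htam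

end Record

end Summit.BirchSwinnertonDyer.Rank1Residual.X11b.Three

end
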